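import Mathlib
import Summits.NavierStokesRegularity.NavierStokesRegularity.Theorems.WakeRatchetTailRatchetQuietPastUniform
import HarnessLib

/-!
# `WakeRatchet.TailRatchet` (stmt-NavierStokesRegularity-21808) — hypothesis class of the tail ratchets, VISCOUS slice:
# in the far past every shell above the DISSIPATION LINE is quiet, so the loud activity sits below it and drifts to `n → −∞`

Support file (route `WakeRatchet`; MODEL lattice ODEs of Tao 2016 §4 / §6.4 — nothing here concerns the Navier–Stokes
equations; no item is closed).  Sixth file of the `WakeRatchetQuietPast` series; relevant to the `ν̂ > 0` stub
`stub_viscous` of the line `birth` and to the live slices stmt-25647 (`EternalViscousRate`) / stmt-20419.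

For a uniformly bounded (`‖W_j‖ ≤ C`) admissible eternal solution with covariant viscosity `ν̂ > 0` of ANY table
(`K` a bound of `C_Q + Λ C_A + Λ⁻¹ C_B`), the viscous coefficient of shell `k` at log-time `σ` is
`v_k(σ) = ν̂ (1+ε₀)^{2k} e^{−σ}` — it grows without bound in the past of every FIXED shell.

* `sq_deriv_le_visc` — `(‖W_k‖²)' ≤ 2KC³ − 2 v_k(σ) ‖W_k‖²`;
* `sq_le_max_of_visc` — BARRIER: on a log-time interval where `v_k δ₁² ≥ 4KC³ + 1`, `‖W_k‖²` never crosses the level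
  `δ₁²` upward: `‖W_k(s)‖² ≤ max(‖W_k(σ)‖², δ₁²)` for `σ ≤ s` (Mathlib's `image_le_of_deriv_right_lt_deriv_boundary'`);
* `quiet_above_viscous_line` — hence, by the ACTION clause (`∫‖W_k‖ < ∞`), shell `k` is QUIET (`‖W_k(σ)‖ ≤ δ₁`) at every
  log-time `σ` with `v_k(σ) δ₁² ≥ 4KC³ + 1`: otherwise it would stay above `δ₁` on the whole half-line `(−∞, σ]`;
* `loud_below_viscous_line` — combined with the uniform backward floor (`uniformly_loud_past`, `δ₀ = 1/(64K)`): there is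
  `σ₀` such that at every `σ ≤ σ₀` some shell is loud (`> δ₀`) and EVERY loud shell has dissipation number
  `v_k(σ) < (4KC³+1)(64K)²` — the far-past activity of a non-trivial viscous eternal solution lives strictly below the
  dissipation line;
* `loud_shells_below` — consequently the loud shells drift to `−∞`: for every `N` there is `σ₀` such that at every `σ ≤ σ₀`
  some shell is loud and every loud shell has index `< N`.

HONEST FRAMING: elementary real analysis for a MODEL lattice ODE; no stub, crux, rung or summit is proved (stmt-21808 stays
dead modulo the construction `WakeRatchetDyadicFront.DyadicScalarFronts`).
-/

noncomputable section

set_option linter.dupNamespace false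

namespace Summit.NavierStokesRegularity.NavierStokesRegularity.Theorems

namespace WakeRatchetQuietPast

open Set Filter Topology MeasureTheory
open scoped RealInnerProductSpace
open Literature.Analysis.FluidPDE Literature.Analysis.FluidPDE.TaoCascade

variable {m : ℕ} {ε₀ νh : ℝ} {α : Fin m → Fin m → Fin m → ℤ × ℤ × ℤ → ℝ} {W : ℤ → ℝ → Em m}

/-! ## The shell energy feels the full viscous coefficient -/

/-- **Energy derivative with the viscous term kept.**  If `‖W_j‖ ≤ C` everywhere then
`(‖W_k‖²)'(u) ≤ 2KC³ − 2 v_k(u) ‖W_k(u)‖²`, `v_k(u) = ν̂ (1+ε₀)^{2k} e^{−u}`.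
[cite: Tao2016AveragedNS, §4 Lemma 4.1 (4.8) with the viscous equation before Thm. 4.2, §6.4; cell lemma] -/
theorem sq_deriv_le_visc (hε : -1 < ε₀) (hW : IsEternalVisc ε₀ νh α W) {K C : ℝ}
    (hK : shiftConst α (0, 0, 0) + bigLam ε₀ * shiftConst α (0, 0, 1)
      + (bigLam ε₀)⁻¹ * (shiftConst α (1, 0, 0) + shiftConst α (0, 1, 0)) ≤ K)
    (hC0 : 0 ≤ C) (hC : ∀ (j : ℤ) (σ : ℝ), ‖W j σ‖ ≤ C) (k : ℤ) (u : ℝ) :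
    ∃ d : ℝ, HasDerivAt (fun y => ‖W k y‖ ^ 2) d u ∧
      d ≤ 2 * K * C ^ 3 - 2 * (νh * ((1 + ε₀) ^ ((2 : ℝ) * k) * Real.exp (-u))) * ‖W k u‖ ^ 2 := by
  have hlaw := hW.law k u
  set N : Em m := tableQ α (W k u) + bigLam ε₀ • tableA α (W (k - 1) u)
    + (bigLam ε₀)⁻¹ • tableB α (W (k + 1) u) (W k u) with hN
  set v : ℝ := νh * ((1 + ε₀) ^ ((2 : ℝ) * k) * Real.exp (-u)) with hv
  have hderiv_eq : -((1 : ℝ) • W k u) + tableQ α (W k u) + bigLam ε₀ • tableA α (W (k - 1) u)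
      + (bigLam ε₀)⁻¹ • tableB α (W (k + 1) u) (W k u) - v • W k u = N - (1 + v) • W k u := by
    rw [hN, add_smul, one_smul]; abel
  have hlaw' : HasDerivAt (W k) (N - (1 + v) • W k u) u := hlaw.congr_deriv hderiv_eq
  refine ⟨_, hlaw'.norm_sq, ?_⟩
  have hinner : ⟪W k u, N - (1 + v) • W k u⟫ = ⟪W k u, N⟫ - (1 + v) * ‖W k u‖ ^ 2 := by
    rw [inner_sub_right, inner_smul_right, real_inner_self_eq_norm_sq]
  have hWN : ⟪W k u, N⟫ ≤ ‖W k u‖ * ‖N‖ := real_inner_le_norm _ _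
  have hNle : ‖N‖ ≤ K * C ^ 2 :=
    norm_quad_le_of_bound hε hK hC0 (hC k u) (hC (k - 1) u) (hC (k + 1) u)
  have hprod : ‖W k u‖ * ‖N‖ ≤ C * (K * C ^ 2) := mul_le_mul (hC k u) hNle (norm_nonneg _) hC0
  rw [hinner]
  nlinarith [hWN, hprod, sq_nonneg ‖W k u‖]

/-- The viscous coefficient `v_k(σ) = ν̂ (1+ε₀)^{2k} e^{−σ}` is non-increasing in `σ` (for `ν̂ ≥ 0`, `1 + ε₀ > 0`).
[cite: Tao2016AveragedNS, §4 (viscous equation before Thm. 4.2), §6.4; cell lemma] -/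
theorem visc_antitone (hε : -1 < ε₀) (hν : 0 ≤ νh) (k : ℤ) {σ s : ℝ} (hσs : σ ≤ s) :
    νh * ((1 + ε₀) ^ ((2 : ℝ) * k) * Real.exp (-s)) ≤ νh * ((1 + ε₀) ^ ((2 : ℝ) * k) * Real.exp (-σ)) := by
  have hb : 0 < (1 + ε₀) ^ ((2 : ℝ) * k) := Real.rpow_pos_of_pos (by linarith) _
  have he : Real.exp (-s) ≤ Real.exp (-σ) := Real.exp_le_exp.2 (by linarith)
  exact mul_le_mul_of_nonneg_left (mul_le_mul_of_nonneg_left he hb.le) hν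

/-! ## The barrier: above the dissipation line the level `δ₁` cannot be crossed upward -/

/-- **Barrier.**  If `‖W_j‖ ≤ C` and at log-time `sₘ` the viscous coefficient of shell `k` satisfies
`v_k(sₘ) δ₁² ≥ 4KC³ + 1` (hence at all earlier log-times), then for `σ ≤ s ≤ sₘ`:
`‖W_k(s)‖² ≤ max(‖W_k(σ)‖², δ₁²)`. [cite: Tao2016AveragedNS, §4 Lemma 4.1 (4.8), §6.4; cell lemma] -/
theorem sq_le_max_of_visc (hε : -1 < ε₀) (hW : IsEternalVisc ε₀ νh α W) {K C δ₁ sₘ : ℝ}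
    (hK : shiftConst α (0, 0, 0) + bigLam ε₀ * shiftConst α (0, 0, 1)
      + (bigLam ε₀)⁻¹ * (shiftConst α (1, 0, 0) + shiftConst α (0, 1, 0)) ≤ K)
    (hC0 : 0 ≤ C) (hC : ∀ (j : ℤ) (σ : ℝ), ‖W j σ‖ ≤ C) (k : ℤ)
    (hvis : 4 * K * C ^ 3 + 1 ≤ νh * ((1 + ε₀) ^ ((2 : ℝ) * k) * Real.exp (-sₘ)) * δ₁ ^ 2)
    {σ s : ℝ} (hσs : σ ≤ s) (hs : s ≤ sₘ) :
    ‖W k s‖ ^ 2 ≤ max (‖W k σ‖ ^ 2) (δ₁ ^ 2) := by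
  set φ : ℝ → ℝ := fun y => ‖W k y‖ ^ 2 with hφ
  have hcont : Continuous φ := (WakeRatchetOrthant.continuous_shell hW k).norm.pow 2
  -- derivative function and its bound
  have hder : ∀ x, HasDerivAt φ (deriv φ x) x ∧
      deriv φ x ≤ 2 * K * C ^ 3 - 2 * (νh * ((1 + ε₀) ^ ((2 : ℝ) * k) * Real.exp (-x))) * ‖W k x‖ ^ 2 := by
    intro x
    obtain ⟨d, hd, hdle⟩ := sq_deriv_le_visc hε hW hK hC0 hC k x
    rw [hd.deriv]; exact ⟨hd, hdle⟩
  set B : ℝ := max (‖W k σ‖ ^ 2) (δ₁ ^ 2) with hB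
  have hres := image_le_of_deriv_right_lt_deriv_boundary' (f := φ) (f' := deriv φ) (a := σ) (b := s)
    hcont.continuousOn (fun x _ => (hder x).1.hasDerivWithinAt)
    (B := fun _ => B) (B' := fun _ => 0) (le_max_left _ _) continuousOn_const
    (fun x _ => (hasDerivAt_const x B).hasDerivWithinAt) ?_
  · exact hres ⟨hσs, le_rfl⟩
  · intro x hx hxB
    -- at a contact point `φ x = B ≥ δ₁²` the derivative is negative
    have hxs : x ≤ sₘ := (le_of_lt hx.2).trans hs
    have hvx := visc_antitone hε hW.nonneg k hxs
    have hφx : δ₁ ^ 2 ≤ ‖W k x‖ ^ 2 := by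
      have : φ x = B := hxB
      rw [hφ] at this
      simp only at this
      rw [this]; exact le_max_right _ _
    have hv0 : 0 ≤ νh * ((1 + ε₀) ^ ((2 : ℝ) * k) * Real.exp (-x)) :=
      mul_nonneg hW.nonneg (mul_nonneg (Real.rpow_pos_of_pos (by linarith) _).le (Real.exp_pos _).le)
    have h1 : 4 * K * C ^ 3 + 1 ≤ νh * ((1 + ε₀) ^ ((2 : ℝ) * k) * Real.exp (-x)) * ‖W k x‖ ^ 2 :=
      hvis.trans (mul_le_mul hvx hφx (sq_nonneg _) hv0)
    have h2 := (hder x).2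
    have h3 : 2 * (νh * ((1 + ε₀) ^ ((2 : ℝ) * k) * Real.exp (-x))) * ‖W k x‖ ^ 2
        = 2 * (νh * ((1 + ε₀) ^ ((2 : ℝ) * k) * Real.exp (-x)) * ‖W k x‖ ^ 2) := by ring
    rw [h3] at h2
    have hK0 : 0 ≤ K := tableConst_nonneg hε hK
    have hKC : 0 ≤ K * C ^ 3 := by positivity
    show deriv φ x < 0
    linarith

/-! ## Quiet above the dissipation line (uses the action clause) -/

/-- **Every shell is quiet above the dissipation line.**  For a uniformly bounded admissible eternal solution with
`ν̂ ≥ 0` and any `δ₁ > 0`: at every log-time `σ` with `v_k(σ) δ₁² ≥ 4KC³ + 1` one has `‖W_k(σ)‖ ≤ δ₁` — otherwise, by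
the barrier, `‖W_k‖ > δ₁` on the whole half-line `(−∞, σ]`, contradicting `∫ ‖W_k‖ < ∞`.
[cite: Tao2016AveragedNS, §4 Lemma 4.1 (4.8), §6.4; cell theorem] -/
theorem quiet_above_viscous_line (hε : -1 < ε₀) (hW : IsEternalVisc ε₀ νh α W) {K C δ₁ : ℝ}
    (hK : shiftConst α (0, 0, 0) + bigLam ε₀ * shiftConst α (0, 0, 1)
      + (bigLam ε₀)⁻¹ * (shiftConst α (1, 0, 0) + shiftConst α (0, 1, 0)) ≤ K)
    (hC0 : 0 ≤ C) (hC : ∀ (j : ℤ) (σ : ℝ), ‖W j σ‖ ≤ C) (hδ₁ : 0 < δ₁) (k : ℤ) {σ : ℝ}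
    (hvis : 4 * K * C ^ 3 + 1 ≤ νh * ((1 + ε₀) ^ ((2 : ℝ) * k) * Real.exp (-σ)) * δ₁ ^ 2) :
    ‖W k σ‖ ≤ δ₁ := by
  by_contra hgt
  push Not at hgt
  have hσsq : δ₁ ^ 2 < ‖W k σ‖ ^ 2 := by
    have := pow_lt_pow_left₀ hgt hδ₁.le two_ne_zero
    exact this
  -- the level persists on the whole past half-line
  have hpast : ∀ τ : ℝ, τ ≤ σ → δ₁ ≤ ‖W k τ‖ := by
    intro τ hτ
    have hbar := sq_le_max_of_visc hε hW hK hC0 hC k hvis hτ le_rfl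
    -- `‖W_k(σ)‖² ≤ max(‖W_k(τ)‖², δ₁²)` with `‖W_k(σ)‖² > δ₁²` forces `‖W_k(τ)‖² ≥ ‖W_k(σ)‖²`
    have hτsq : δ₁ ^ 2 ≤ ‖W k τ‖ ^ 2 := by
      by_contra hlt
      push Not at hlt
      have : max (‖W k τ‖ ^ 2) (δ₁ ^ 2) = δ₁ ^ 2 := max_eq_right hlt.le
      rw [this] at hbar
      linarith
    exact (pow_le_pow_iff_left₀ hδ₁.le (norm_nonneg _) two_ne_zero).1 hτsq
  -- contradiction with integrability of `‖W_k‖`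
  obtain ⟨M, hM⟩ := hW.action
  have hint : Integrable (fun τ => ‖W k τ‖) := (hM k).1
  have hfin := hint.measure_norm_ge_lt_top hδ₁
  have hsub : Iic σ ⊆ {τ : ℝ | δ₁ ≤ ‖(fun τ => ‖W k τ‖) τ‖} := by
    intro τ hτ
    simp only [mem_setOf_eq, Real.norm_eq_abs, abs_norm]
    exact hpast τ hτ
  have hinf : volume (Iic σ) = ⊤ := Real.volume_Iic
  have := measure_mono (μ := volume) hsub
  rw [hinf, top_le_iff] at this
  exact (lt_top_iff_ne_top.1 hfin) this

/-! ## Loud activity sits below the dissipation line and drifts to `−∞` -/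

/-- **Loud shells lie below the dissipation line.**  Let `W` be a NON-TRIVIAL uniformly bounded (`‖W_j‖ ≤ C`) admissible
eternal solution with covariant viscosity `ν̂ ≥ 0` of any table (`K > 0` a bound of the table constant).  Then there is
`σ₀` such that at every log-time `σ ≤ σ₀`: some shell is loud (`‖W_k(σ)‖ > 1/(64K)`), and EVERY loud shell has dissipation
number `v_k(σ) = ν̂ (1+ε₀)^{2k} e^{−σ} < (4KC³ + 1)(64K)²`.
[cite: Tao2016AveragedNS, §4 Lemma 4.1 (4.8), §6.4; cell theorem] -/
theorem loud_below_viscous_line (hε : -1 < ε₀) (hW : IsEternalVisc ε₀ νh α W) {K C : ℝ}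
    (hK : shiftConst α (0, 0, 0) + bigLam ε₀ * shiftConst α (0, 0, 1)
      + (bigLam ε₀)⁻¹ * (shiftConst α (1, 0, 0) + shiftConst α (0, 1, 0)) ≤ K)
    (hK0 : 0 < K) (hC0 : 0 ≤ C) (hC : ∀ (j : ℤ) (σ : ℝ), ‖W j σ‖ ≤ C) (hne : ∃ (n : ℤ) (σ : ℝ), W n σ ≠ 0) :
    ∃ σ₀ : ℝ, ∀ σ : ℝ, σ ≤ σ₀ →
      (∃ k : ℤ, 1 / (64 * K) < ‖W k σ‖) ∧
      (∀ k : ℤ, 1 / (64 * K) < ‖W k σ‖ →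
        νh * ((1 + ε₀) ^ ((2 : ℝ) * k) * Real.exp (-σ)) < (4 * K * C ^ 3 + 1) * (64 * K) ^ 2) := by
  obtain ⟨σ₀, hloud⟩ := uniformly_loud_past hε hW ⟨C, hC⟩ hK hK0 hne
  refine ⟨σ₀, fun σ hσ => ⟨hloud σ hσ, fun k hk => ?_⟩⟩
  by_contra hge
  push Not at hge
  have hδ : (0 : ℝ) < 1 / (64 * K) := by positivity
  have hvis : 4 * K * C ^ 3 + 1 ≤ νh * ((1 + ε₀) ^ ((2 : ℝ) * k) * Real.exp (-σ)) * (1 / (64 * K)) ^ 2 := by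
    have e : (4 * K * C ^ 3 + 1) = (4 * K * C ^ 3 + 1) * (64 * K) ^ 2 * (1 / (64 * K)) ^ 2 := by
      field_simp
    rw [e]
    exact mul_le_mul_of_nonneg_right hge (sq_nonneg _)
  have hq := quiet_above_viscous_line hε hW hK hC0 hC hδ k hvis
  linarith

/-- **The loud shells drift to `n → −∞`** (viscous case `ν̂ > 0`, `ε₀ > 0`).  For every `N : ℤ` there is `σ₀` such that at
every log-time `σ ≤ σ₀` some shell is loud (`> 1/(64K)`) and every loud shell has index `< N`: in the far past a
non-trivial bounded admissible viscous eternal solution is active only at arbitrarily low shells.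
[cite: Tao2016AveragedNS, §4 Lemma 4.1 (4.8), §6.4; cell theorem] -/
theorem loud_shells_below (hε : 0 < ε₀) (hν : 0 < νh) (hW : IsEternalVisc ε₀ νh α W) {K C : ℝ}
    (hK : shiftConst α (0, 0, 0) + bigLam ε₀ * shiftConst α (0, 0, 1)
      + (bigLam ε₀)⁻¹ * (shiftConst α (1, 0, 0) + shiftConst α (0, 1, 0)) ≤ K)
    (hK0 : 0 < K) (hC0 : 0 ≤ C) (hC : ∀ (j : ℤ) (σ : ℝ), ‖W j σ‖ ≤ C) (hne : ∃ (n : ℤ) (σ : ℝ), W n σ ≠ 0)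
    (N : ℤ) :
    ∃ σ₀ : ℝ, ∀ σ : ℝ, σ ≤ σ₀ →
      (∃ k : ℤ, 1 / (64 * K) < ‖W k σ‖) ∧ (∀ k : ℤ, 1 / (64 * K) < ‖W k σ‖ → k < N) := by
  obtain ⟨σ₀, h⟩ := loud_below_viscous_line (by linarith) hW hK hK0 hC0 hC hne
  set V : ℝ := (4 * K * C ^ 3 + 1) * (64 * K) ^ 2 with hV
  have hV0 : 0 < V := by rw [hV]; positivity
  have hb1 : (1 : ℝ) < 1 + ε₀ := by linarith
  have hb0 : (0 : ℝ) < 1 + ε₀ := by linarith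
  -- choose `σ₁` with `V e^{σ₁} ≤ ν̂ (1+ε₀)^{2N}`: then a shell `k ≥ N` loud at `σ ≤ σ₁` would violate `v_k(σ) < V`
  set σ₁ : ℝ := Real.log (νh * (1 + ε₀) ^ ((2 : ℝ) * N) / V) with hσ₁
  have hpowN : 0 < (1 + ε₀) ^ ((2 : ℝ) * N) := Real.rpow_pos_of_pos hb0 _
  refine ⟨min σ₀ σ₁, fun σ hσ => ⟨(h σ (hσ.trans (min_le_left _ _))).1, fun k hk => ?_⟩⟩
  have hv := (h σ (hσ.trans (min_le_left _ _))).2 k hk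
  by_contra hkN
  push Not at hkN
  -- `(1+ε₀)^{2N} ≤ (1+ε₀)^{2k}` and `e^{-σ} ≥ e^{-σ₁} = V / (ν̂ (1+ε₀)^{2N})`
  have hpow : (1 + ε₀) ^ ((2 : ℝ) * N) ≤ (1 + ε₀) ^ ((2 : ℝ) * k) :=
    Real.rpow_le_rpow_of_exponent_le hb1.le (by
      have : (N : ℝ) ≤ (k : ℝ) := by exact_mod_cast hkN
      linarith)
  have hexp : Real.exp (-σ₁) ≤ Real.exp (-σ) := Real.exp_le_exp.2 (by linarith [hσ.trans (min_le_right σ₀ σ₁)])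
  have hexpσ₁ : Real.exp (-σ₁) = V / (νh * (1 + ε₀) ^ ((2 : ℝ) * N)) := by
    rw [hσ₁, Real.exp_neg, Real.exp_log (by positivity), inv_div]
  have hge : V ≤ νh * ((1 + ε₀) ^ ((2 : ℝ) * k) * Real.exp (-σ)) := by
    calc V = νh * ((1 + ε₀) ^ ((2 : ℝ) * N) * Real.exp (-σ₁)) := by
          rw [hexpσ₁]; field_simp
      _ ≤ νh * ((1 + ε₀) ^ ((2 : ℝ) * k) * Real.exp (-σ)) :=
          mul_le_mul_of_nonneg_left (mul_le_mul hpow hexp (Real.exp_pos _).le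
            (Real.rpow_pos_of_pos hb0 _).le) hν.le
  linarith

end WakeRatchetQuietPast

end Summit.NavierStokesRegularity.NavierStokesRegularity.Theorems

end
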